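/-
Copyright (c) 2026 the pub-hodgecm-mathlib formalisation cell (harness21).  Prover seat hodgecm-mathlib-LH4-p06 (g4), Track A «(D-RAM) FOUR-FRAME», unit U2H, the census leaf
(ρ2b′-X) — T5c «TORIC LEVEL CENSUS, M∕E-RAMIFIED» (dealer LH4-plan (g12) WORD #16∕#21∕#22): the RamM value of `|G_j|`; ramified twin of LH4-p08 (g4)'s
`QuadraticOrderTorusIndices.relIndex_orderUnits_eq_of_unramified`.  2026-09-04.
-/
import Literature.NumberTheory.LocalFields.WildQuadraticDatumUnitDepthIndex   -- ★ p857227 (LH4-p08 (g4)): Mars' index in valued currency, `relIndex_eq_pow_of_depth`, `exists_subgroup_depth`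
import Literature.NumberTheory.Automorphic.UnitaryThreeFourFrameDefs         -- ★ #0a: `IsRamifiedQuadraticDatum`
import HarnessLib

/-!
# `|G_j| = [𝒪_Mˣ : 𝒪_jˣ] = q^j` when `M ∕ E` is RAMIFIED: the order-unit index of `𝒪_j = 𝒪_E + ϖ_E^j𝒪_M` read on the ramified quadratic datum `(M, ρ, α, d_ρ)`
(Flicker 1998 Prop. 7 p. 84 ∕ §6 p. 95 (Mars); Serre, *Local Fields* Ch. V §3)

Topic `NumberTheory/LocalFields`; namespace `Literature.NumberTheory.LocalFields.QuadraticOrder` (= ★ T4 ∕ LH4-p08 (g4)'s F4 organs).  THEOREMS ONLY (no definition, no instance,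
no notation, no named fact, no `sorry`); kernel lane `--supports stmt-HodgeConjecture-24833` (count-neutral).  Cell `pub/hodgecm-mathlib` (D-0151), crux H413, Track A «(D-RAM)
FOUR-FRAME», unit U2H: in the toric ∕ order reduction of the WILD type-(2) fixed-point census (ρ2b′-X) the per-level lattice counts of type RamM are `|G_j|·(F − F)` with
`|G_j| := [𝒪_Mˣ : 𝒪_jˣ]` (F0P3-p01 (g32) RamM INDEX-LEMMAS §A; this seat's T5c sheet v5 (S2)).  For `M ∕ E` UNRAMIFIED that index is `(q+1)q^{j−1}` (Flicker, LH4-p08 (g4)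
`relIndex_orderUnits_eq_of_unramified`); for `M ∕ E` RAMIFIED it is **`q^j`**, and it is ★ p857227 READ ON THE DATUM `(M, ρ, α, d_ρ)`: the order units
`𝒪_jˣ = {u : |u| = 1 ∧ |u − ρu| ≤ |ϖE^j(α − ρα)|}` ARE Mars' depth subgroup at level `d_ρ + 2j` because `|ϖE| = |α|²` and `|α − ρα| = |α|^{d_ρ}` — this file is that reading
(no new index theory):
* `v_conductor_mul_eq_v_pow` — `|ϖE^j(α − ρα)| = |α^{d_ρ + 2j}|` (`|ϖE| = exp(−2)`, `|α| = exp(−1)`, `|α − ρα| = |α|^{d_ρ}`).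
* **`relIndex_orderUnits_eq_of_ramified`** — for binder-characterised `U = {|u| = 1}`, `V = {|u| = 1 ∧ |u − ρu| ≤ |ϖE^j(α − ρα)|}` ≤ `Mˣ`: `V.relIndex U = q^j`; and the
  ★-datum-packaged form `relIndex_orderUnits_eq_of_isRamifiedQuadraticDatum` (the subgroup `V` exists def-free: ★ p857298 `exists_subgroup_orderUnits`).
HONEST LABEL: HC_CM is proved only modulo the 7 printed citations (2 remaining named inputs: hLiu418 = stmt-HodgeConjecture-24832, h413 = stmt-HodgeConjecture-24833) until rung 0
closes; unconditional local algebra, count-neutral (organ `|G_j|` of the RamM census; nothing of the census asserted).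

## References
* [Flicker1998UnitaryFL] Y. Z. Flicker, *Elementary proof of the fundamental lemma for a unitary group*, Canad. J. Math. 50 (1998): Prop. 7 p. 84; §6 p. 95 REMARK (Mars' index).
* [Serre1979] J.-P. Serre, *Local Fields*, GTM 67 (1979): Ch. V §3 (the unit filtration of a ramified quadratic extension), Ch. III §6 Prop. 12 (orders).
-/

set_option autoImplicit false

open WithZero IsLocalRing
open scoped Valued
open Literature.NumberTheory.Automorphic.UnitaryThreeFourFrame (IsRamifiedQuadraticDatum)
open Literature.NumberTheory.LocalFields.WildQuadraticDatum (relIndex_eq_pow_of_depth)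

namespace Literature.NumberTheory.LocalFields.QuadraticOrder

variable {K : Type} [Field K] [Valued K ℤᵐ⁰] {ρ : K →+* K} {α ϖE : K} {dρ : ℕ}

/-- **THE CONDUCTOR BOUND IS A DEPTH**: `|ϖE^j·(α − ρα)| = |α^{d_ρ + 2j}|` when `|ϖE| = exp(−2)`, `|α| = exp(−1)`, `|α − ρα| = |α|^{d_ρ}` (the order of conductor `ϖE^j`
is Mars' level `d_ρ + 2j`). [cite: Serre1979, Ch. III §6 Prop. 12] -/
theorem v_conductor_mul_eq_v_pow (hα : Valued.v α = exp (-1 : ℤ)) (hdρ : Valued.v (α - ρ α) = Valued.v α ^ dρ) (hϖE : Valued.v ϖE = exp (-2 : ℤ)) (j : ℕ) :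
    Valued.v (ϖE ^ j * (α - ρ α)) = Valued.v (α ^ (dρ + 2 * j)) := by
  rw [map_mul, map_pow, map_pow, hdρ, hϖE, hα, ← exp_nsmul, ← exp_nsmul, ← exp_nsmul, ← exp_add]
  congr 1
  simp only [nsmul_eq_mul]
  push_cast
  ring

/-- **`[𝒪_Mˣ : 𝒪_jˣ] = q^j` FOR `M ∕ E` RAMIFIED** — binder-characterised subgroups of `Mˣ`: `u ∈ U ↔ |u| = 1`, `u ∈ V ↔ |u| = 1 ∧ |u − ρu| ≤ |ϖE^j(α − ρα)|` (the units of
the order of conductor `ϖE^j`); then `V.relIndex U = q^j` (`q = #𝓀[M]`).  ★ Mars' valued-currency index `relIndex_eq_pow_of_depth` on the datum `(ρ, α, d_ρ)` at level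
`d_ρ + 2j`. [cite: Flicker1998UnitaryFL, Prop. 7 p. 84] [cite: Serre1979, Ch. V §3] -/
theorem relIndex_orderUnits_eq_of_ramified [IsDiscreteValuationRing 𝒪[K]] [Finite 𝓀[K]]
    (hρρ : ∀ x, ρ (ρ x) = x) (hvρ : ∀ x, Valued.v (ρ x) = Valued.v x) (hfix : ∀ x : K, ρ x = x → x ≠ 0 → ∃ n : ℤ, Valued.v x = exp (2 * n))
    (hα : Valued.v α = exp (-1 : ℤ)) (hdρ : Valued.v (α - ρ α) = Valued.v α ^ dρ) (hϖE : Valued.v ϖE = exp (-2 : ℤ))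
    {q : ℕ} (hq : Nat.card 𝓀[K] = q) (j : ℕ) (U V : Subgroup Kˣ) (hU : ∀ u, u ∈ U ↔ Valued.v (u : K) = 1)
    (hV : ∀ u, u ∈ V ↔ Valued.v (u : K) = 1 ∧ Valued.v ((u : K) - ρ u) ≤ Valued.v (ϖE ^ j * (α - ρ α))) :
    V.relIndex U = q ^ j := by
  refine relIndex_eq_pow_of_depth hρρ hvρ hfix hα hdρ hq j U V hU (fun u => ?_)
  rw [hV u, v_conductor_mul_eq_v_pow hα hdρ hϖE j, Valuation.map_sub_swap]

/-- The same with the hypotheses packaged as ★ `IsRamifiedQuadraticDatum ρ α d_ρ t` on `M` (the first conjunct of the T5c frame). [cite: Flicker1998UnitaryFL, Prop. 7 p. 84] -/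
theorem relIndex_orderUnits_eq_of_isRamifiedQuadraticDatum [IsDiscreteValuationRing 𝒪[K]] [Finite 𝓀[K]] {t : ℕ} (hD : IsRamifiedQuadraticDatum ρ α dρ t)
    (hϖE : Valued.v ϖE = exp (-2 : ℤ)) {q : ℕ} (hq : Nat.card 𝓀[K] = q) (j : ℕ) (U V : Subgroup Kˣ) (hU : ∀ u, u ∈ U ↔ Valued.v (u : K) = 1)
    (hV : ∀ u, u ∈ V ↔ Valued.v (u : K) = 1 ∧ Valued.v ((u : K) - ρ u) ≤ Valued.v (ϖE ^ j * (α - ρ α))) :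
    V.relIndex U = q ^ j := by
  obtain ⟨hρρ, hvρ, hα, hfix, hdρ, -, -⟩ := hD
  exact relIndex_orderUnits_eq_of_ramified hρρ hvρ hfix hα hdρ hϖE hq j U V hU hV

end Literature.NumberTheory.LocalFields.QuadraticOrder
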